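import Summits.QuantumFields.BalabanUV.T4Continuum.Spine.NE1p.B7AveragingCurvedBackground
import Summits.QuantumFields.BalabanUV.T4Continuum.Spine.NE1p.B7AveragingPureGaugeCommutator

/-!
# T⁴ programme, spine estimate NE1′ (node O3b/H2) — door (c) at level 1, GAUGE-INVARIANT FORM: the diagonal curvature bound
# «∝ non-flatness» for every background on the gauge orbit `(e^{B})^{u}` of a small connection `B`

Cell `pub-balaban-gaps` (YM blitz Y1, track G2), seat `ne1` gen 10 (prover-pub-balaban-gaps-ne1-g10-0); record `HOME/ne/NE1.md` v10.x R63
(the gauge step).  ADDITIVE — imports this seat's `B7AveragingCurvedBackground` (file 16: the level-1 bound at backgrounds `e^{B}`) and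
`B7AveragingPureGaugeCommutator` (file 13: conjugation through local derivative data); the lineages' (8) `gaugeAct`, (45)
`bavg_gaugeAct`, (23) `mlog_units_conj`, `U1` BY NAME; `[NormOneClass 𝔸]`; 0 def.

WHAT THIS FILE PROVES ([folklore] bookkeeping; 0 sorry).  `u : ℤᵈ → 𝔸ˣ` with `u, u⁻¹` in the unit ball, `B` a background generator
with `‖B(b)‖ ≤ b`, `A` a slot field with TRANSPORTED field `A′` (`A(b) = u(b₋)A′(b)u(b₋)⁻¹`), `‖A′(b)‖ ≤ a`, `ℓ = 2dL + 2L`: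
* `expCfg_smul_mul_gaugeAct` — `e^{tA}·(e^{B})^{u} = (e^{tA′}·e^{B})^{u}` exactly ((8));
* `eventually_mlog_bavg_gauge_ratio` — for `ℓ·b ≤ 1∕40` (so that all loops stay inside the radius of (21) for small `t`, files 14∕15):
  near `t = 0`, `log( Ū_c(e^{tA}(e^{B})^{u}) · Ū_c((e^{B})^{u})⁻¹ ) = u(c₋) · log( Ū_c(e^{tA′}e^{B}) · Ū_c(e^{B})⁻¹ ) · u(c₋)⁻¹`;
* `iteratedDeriv_two_mlog_bavg_gauge_ratio` — the quadratic term at the background `(e^{B})^{u}` is the CONJUGATE of the one at `e^{B}`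
  for the transported slot (local derivative data from holomorphy, file 15; conjugation lemma, file 13);
* **`norm_curvature_gaugeOrbit_le_of_commute` — if the transported slot values pairwise commute (every ONE-PARAMETER slot), `0 < a`,
  `0 < b`, `ℓ·b ≤ 1∕80`: `‖∂_t²|₀ log( Ū_c(e^{tA}(e^{B})^{u}) · Ū_c((e^{B})^{u})⁻¹ )‖ ≤ 1024000·ℓ³·a²·b`** — file 16's «diagonal
  curvature ∝ non-flatness» for EVERY background gauge-equivalent (by a unit-ball gauge) to a connection `e^{B}` with `sup‖B‖ ≤ b`:
  the bound sees only the gauge-invariant size of the background's generator, never the gauge `u`.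
What it does NOT do: backgrounds with small plaquette variables on the block ONLY (the axial gauge of [B7] (44) makes `B` small near the
block, growing with the distance — needs localized size hypotheses in files 14–16 or a locality lemma for `Ū_c`), higher levels, RG densities.

HONEST FRAMING.  [folklore]; nothing of Bałaban's asserted; NE1′ NOT proved; spine 0∕9; (B) 0∕13; binders 0∕6; one fixed finite T⁴ — NOT ℝ⁴,
NOT infinite volume, NOT a mass gap, NOT Clay.
-/

noncomputable section

open scoped Topology
open NormedSpace Filter Metric

namespace Summit.QuantumFields.BalabanUV.T4Continuum.NE1p.B7AveragingCommutator

open Literature.MathematicalPhysics.QuantumFieldTheory.Balaban1983to89.MatrixLog (mlog analyticAt_mlog)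
open Literature.MathematicalPhysics.QuantumFieldTheory.Balaban1983to89.B7Prop1Explicit
open Literature.MathematicalPhysics.QuantumFieldTheory.Balaban1983to89.B7Prop3Flat (expCfg)
open Literature.MathematicalPhysics.QuantumFieldTheory.Balaban1983to89.B7Prop3GeneralRotated (expCfg_zero)

variable {𝔸 : Type*} [NormedRing 𝔸] [NormOneClass 𝔸] [NormedAlgebra ℂ 𝔸] [CompleteSpace 𝔸]

section Gauge

variable {d : ℕ} (L : ℕ) {u : Site d → 𝔸ˣ} (hu : ∀ x, u x ∈ U1 𝔸) {A A' B : Site d → Fin d → 𝔸}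
  (hAA' : ∀ (x : Site d) (μ : Fin d), A x μ = (u x : 𝔸) * A' x μ * (((u x)⁻¹ : 𝔸ˣ) : 𝔸))

include hAA' in
omit [NormOneClass 𝔸] in
/-- **`e^{tA}·(e^{B})^{u} = (e^{tA′}·e^{B})^{u}`**: a perturbation of the gauge-transformed background is the gauge transform of the
transported perturbation of the background ((8); `exp(uXu⁻¹) = u·exp X·u⁻¹`). [cite: Balaban1985Averaging, (8) p.18, (11) p.18] -/
theorem expCfg_smul_mul_gaugeAct (t : ℂ) :
    expCfg (t • A) * gaugeAct u (expCfg B) = gaugeAct u (expCfg (t • A') * expCfg B) := by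
  letI : NormedAlgebra ℚ 𝔸 := NormedAlgebra.restrictScalars ℚ ℂ 𝔸
  funext x μ
  apply Units.ext
  have e1 : t • A x μ = (u x : 𝔸) * (t • A' x μ) * (((u x)⁻¹ : 𝔸ˣ) : 𝔸) := by
    rw [hAA', mul_smul_comm, smul_mul_assoc]
  show exp ((t • A) x μ) * ((u x * expCfg B x μ * (u (x + e μ))⁻¹ : 𝔸ˣ) : 𝔸)
    = ((u x * (expUnit ((t • A') x μ) * expCfg B x μ) * (u (x + e μ))⁻¹ : 𝔸ˣ) : 𝔸)
  simp only [Pi.smul_apply]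
  rw [e1, exp_units_conj]
  simp only [Units.val_mul, val_expUnit, mul_assoc, Units.inv_mul_cancel_left]

variable {a b : ℝ} (ha : ∀ (y : Site d) (μ : Fin d), ‖A' y μ‖ ≤ a) (hb : ∀ (y : Site d) (μ : Fin d), ‖B y μ‖ ≤ b)
  (hann : 0 ≤ a) (hbnn : 0 ≤ b)

include hu hAA' ha hb hann hbnn

/-- **The covariant logarithm at `(e^{B})^{u}` is the conjugated one at `e^{B}` for the transported slot**: if `ℓ·b ≤ 1∕40` then near
`t = 0`, `log( Ū_c(e^{tA}(e^{B})^{u}) · Ū_c((e^{B})^{u})⁻¹ ) = u(c₋)·log( Ū_c(e^{tA′}e^{B}) · Ū_c(e^{B})⁻¹ )·u(c₋)⁻¹` ((45) twice — the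
loops of `e^{tA′}e^{B}` and of `e^{B}` are inside the radius of (21) for `ℓ(‖t‖a + b) ≤ 1∕20`, file 14 — and (23), the ratio being within
`1∕2` of `1`, file 15). [cite: Balaban1985Averaging, (45) p.24, (23) p.21] -/
theorem eventually_mlog_bavg_gauge_ratio (hL : 1 ≤ L) (hB : (2 * d * L + 2 * L) * b ≤ 1 / 40) (q : Site d) (κ : Fin d) :
    ∀ᶠ t in 𝓝 (0 : ℂ),
      mlog (((bavg L (expCfg (t • A) * gaugeAct u (expCfg B)) q κ * (bavg L (gaugeAct u (expCfg B)) q κ)⁻¹ : 𝔸ˣ) : 𝔸))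
        = (u q : 𝔸) * mlog (((bavg L (expCfg (t • A') * expCfg B) q κ * (bavg L (expCfg B) q κ)⁻¹ : 𝔸ˣ) : 𝔸))
            * (((u q)⁻¹ : 𝔸ˣ) : 𝔸) := by
  have hℓ : (0 : ℝ) < 2 * d * L + 2 * L := by
    have hL1 : (1 : ℝ) ≤ L := by exact_mod_cast hL
    have : (0 : ℝ) ≤ 2 * d * L := by positivity
    linarith
  -- a disc in `t` on which `ℓ(‖t‖a + ‖1‖b) ≤ 1∕20`
  obtain ⟨ρ, hρ, hρb⟩ : ∃ ρ : ℝ, 0 < ρ ∧ (2 * d * L + 2 * L) * (ρ * a) ≤ 1 / 40 := by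
    by_cases ha0 : a = 0
    · exact ⟨1, one_pos, by rw [ha0]; simp⟩
    · have hapos : 0 < a := lt_of_le_of_ne hann (Ne.symm ha0)
      refine ⟨1 / (40 * (2 * d * L + 2 * L) * a), by positivity, le_of_eq ?_⟩
      field_simp
  have hdisc : ∀ᶠ t in 𝓝 (0 : ℂ), ‖t‖ ≤ ρ := by
    have : closedBall (0 : ℂ) ρ ∈ 𝓝 (0 : ℂ) := closedBall_mem_nhds 0 hρ
    filter_upwards [this] with t ht
    simpa using ht
  filter_upwards [hdisc] with t ht
  have hpoly : (2 * d * L + 2 * L) * (‖t‖ * a + ‖(1 : ℂ)‖ * b) ≤ 1 / 20 := by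
    rw [norm_one, one_mul, mul_add]
    have : (2 * d * L + 2 * L) * (‖t‖ * a) ≤ (2 * d * L + 2 * L) * (ρ * a) := by gcongr
    linarith
  have hpoly5 : (2 * d * L + 2 * L) * (‖t‖ * a + ‖(1 : ℂ)‖ * b) ≤ 1 / 5 := hpoly.trans (by norm_num)
  have hpoly0 : (2 * d * L + 2 * L) * (‖(0 : ℂ)‖ * a + ‖(1 : ℂ)‖ * b) ≤ 1 / 5 := by
    rw [norm_zero, zero_mul, zero_add, norm_one, one_mul]; linarith
  -- (45) for `e^{tA′}e^{B}` and for `e^{B}`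
  have hW1 : ∀ r : Fin d → Fin L, ‖((Wcx L (expCfg (t • A') * expCfg B) q κ (boxVec L r) : 𝔸ˣ) : 𝔸) - 1‖ < 1 := fun r => by
    have h := norm_Wcx_ray_sub_one_lt ha hb hann hbnn L (1 : ℂ) t hpoly5 q κ r
    rw [one_smul] at h
    exact h.trans (by norm_num)
  have hW0 : ∀ r : Fin d → Fin L, ‖((Wcx L (expCfg B) q κ (boxVec L r) : 𝔸ˣ) : 𝔸) - 1‖ < 1 := fun r => by
    have h := norm_Wcx_ray_sub_one_lt ha hb hann hbnn L (1 : ℂ) 0 hpoly0 q κ r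
    rw [zero_smul, expCfg_zero, one_mul, one_smul] at h
    exact h.trans (by norm_num)
  have hratio : bavg L (expCfg (t • A) * gaugeAct u (expCfg B)) q κ * (bavg L (gaugeAct u (expCfg B)) q κ)⁻¹
      = u q * (bavg L (expCfg (t • A') * expCfg B) q κ * (bavg L (expCfg B) q κ)⁻¹) * (u q)⁻¹ := by
    rw [expCfg_smul_mul_gaugeAct hAA', bavg_gaugeAct L hu _ q κ hW1, bavg_gaugeAct L hu _ q κ hW0]
    group
  have hR : ‖(((bavg L (expCfg (t • A') * expCfg B) q κ * (bavg L (expCfg B) q κ)⁻¹ : 𝔸ˣ)) : 𝔸) - 1‖ < 1 := by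
    have h := norm_ray_ratio_sub_one_le_half ha hb hann hbnn L hL (1 : ℂ) t hpoly q κ
    rw [one_smul] at h
    exact h.trans_lt (by norm_num)
  rw [hratio, Units.val_mul, Units.val_mul, mlog_units_conj (hu q) hR]

/-- **The quadratic term at `(e^{B})^{u}` is the conjugate of the one at `e^{B}` for the transported slot** (`ℓ·b ≤ 1∕40`): the germs
agree (`Filter.EventuallyEq.iteratedDeriv_eq`) and conjugation passes through the local derivative data supplied by holomorphy (file 15's
`differentiableAt_mlog_ray_ratio` on a disc, `DifferentiableOn.analyticAt`, file 13's `iteratedDeriv_two_units_conj`).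
[cite: Balaban1985Averaging, (45) p.24, (42) p.23] -/
theorem iteratedDeriv_two_mlog_bavg_gauge_ratio (hL : 1 ≤ L) (hB : (2 * d * L + 2 * L) * b ≤ 1 / 40) (q : Site d) (κ : Fin d) :
    iteratedDeriv 2 (fun t : ℂ =>
        mlog (((bavg L (expCfg (t • A) * gaugeAct u (expCfg B)) q κ * (bavg L (gaugeAct u (expCfg B)) q κ)⁻¹ : 𝔸ˣ) : 𝔸))) 0
      = (u q : 𝔸) * iteratedDeriv 2 (fun t : ℂ =>
          mlog (((bavg L (expCfg (t • A') * expCfg B) q κ * (bavg L (expCfg B) q κ)⁻¹ : 𝔸ˣ) : 𝔸))) 0 * (((u q)⁻¹ : 𝔸ˣ) : 𝔸) := by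
  rw [Filter.EventuallyEq.iteratedDeriv_eq 2 (eventually_mlog_bavg_gauge_ratio L hu hAA' ha hb hann hbnn hL hB q κ)]
  -- local derivative data of `f(t) = log(Ū_c(e^{tA′}e^{B})Ū_c(e^{B})⁻¹)` from holomorphy on a disc
  have hℓ : (0 : ℝ) < 2 * d * L + 2 * L := by
    have hL1 : (1 : ℝ) ≤ L := by exact_mod_cast hL
    have : (0 : ℝ) ≤ 2 * d * L := by positivity
    linarith
  obtain ⟨ρ, hρ, hρb⟩ : ∃ ρ : ℝ, 0 < ρ ∧ (2 * d * L + 2 * L) * (ρ * a) ≤ 1 / 40 := by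
    by_cases ha0 : a = 0
    · exact ⟨1, one_pos, by rw [ha0]; simp⟩
    · have hapos : 0 < a := lt_of_le_of_ne hann (Ne.symm ha0)
      refine ⟨1 / (40 * (2 * d * L + 2 * L) * a), by positivity, le_of_eq ?_⟩
      field_simp
  have hcond : (2 * d * L + 2 * L) * (ρ * a + ‖(1 : ℂ)‖ * b) ≤ 1 / 20 := by
    rw [norm_one, one_mul, mul_add]; linarith
  set f : ℂ → 𝔸 := fun t : ℂ =>
    mlog (((bavg L (expCfg (t • A') * expCfg B) q κ * (bavg L (expCfg B) q κ)⁻¹ : 𝔸ˣ) : 𝔸)) with hf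
  have hA1 : AnalyticAt ℂ (fun t : ℂ =>
      mlog (((bavg L (expCfg (t • A') * expCfg ((1 : ℂ) • B)) q κ * (bavg L (expCfg ((1 : ℂ) • B)) q κ)⁻¹ : 𝔸ˣ) : 𝔸))) 0 :=
    analyticAt_mlog_ray_ratio ha hb hann hbnn L hL (1 : ℂ) hρ hcond q κ
  simp only [one_smul] at hA1
  -- derivative data: `f′ = deriv f` near `0`, `(deriv f)′(0) = deriv (deriv f) 0`
  have hF : ∀ᶠ t in 𝓝 (0 : ℂ), HasDerivAt f (deriv f t) t := by
    filter_upwards [hA1.eventually_analyticAt] with t ht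
    exact ht.differentiableAt.hasDerivAt
  have hF' : HasDerivAt (deriv f) (deriv (deriv f) 0) 0 := hA1.deriv.differentiableAt.hasDerivAt
  exact iteratedDeriv_two_units_conj (u q) hF hF'

/-- **«DIAGONAL CURVATURE ∝ NON-FLATNESS» AT LEVEL 1, GAUGE-INVARIANT FORM**: for every background on the gauge orbit `(e^{B})^{u}` (`u`
unit-ball valued) of a connection with `sup‖B(b)‖ ≤ b`, `0 < b`, `ℓ·b ≤ 1∕80`, and every slot whose TRANSPORTED values pairwise commute
(every one-parameter slot) with `sup‖A′(b)‖ ≤ a`, `0 < a`: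
`‖∂_t²|₀ log( Ū_c(e^{tA}(e^{B})^{u}) · Ū_c((e^{B})^{u})⁻¹ )‖ ≤ 1024000·ℓ³·a²·b` — file 16's bound transported along the gauge orbit
(`‖u‖, ‖u⁻¹‖ ≤ 1`). [cite: Balaban1985Averaging, (45) p.24, (42) p.23, (44) p.24] -/
theorem norm_curvature_gaugeOrbit_le_of_commute (hL : 1 ≤ L) (ha0 : 0 < a) (hb0 : 0 < b)
    (hB : (2 * d * L + 2 * L) * b ≤ 1 / 80)
    (hA' : ∀ (x : Site d) (κ : Fin d) (y : Site d) (μ : Fin d), Commute (A' x κ) (A' y μ)) (q : Site d) (κ : Fin d) :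
    ‖iteratedDeriv 2 (fun t : ℂ =>
        mlog (((bavg L (expCfg (t • A) * gaugeAct u (expCfg B)) q κ * (bavg L (gaugeAct u (expCfg B)) q κ)⁻¹ : 𝔸ˣ) : 𝔸))) 0‖
      ≤ 1024000 * (2 * d * L + 2 * L) ^ 3 * a ^ 2 * b := by
  rw [iteratedDeriv_two_mlog_bavg_gauge_ratio L hu hAA' ha hb hann hbnn hL (by linarith) q κ]
  have hk := norm_curvature_le_of_commute ha hb ha0 hb0 L hL hB hA' q κ
  set K := iteratedDeriv 2 (fun t : ℂ =>
    mlog (((bavg L (expCfg (t • A') * expCfg B) q κ * (bavg L (expCfg B) q κ)⁻¹ : 𝔸ˣ) : 𝔸))) 0 with hK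
  have hK0 : 0 ≤ ‖K‖ := norm_nonneg _
  calc _ ≤ ‖(u q : 𝔸) * K‖ * ‖(((u q)⁻¹ : 𝔸ˣ) : 𝔸)‖ := norm_mul_le _ _
    _ ≤ (‖(u q : 𝔸)‖ * ‖K‖) * 1 := mul_le_mul (norm_mul_le _ _) (hu q).2 (norm_nonneg _) (by positivity)
    _ ≤ (1 * (1024000 * (2 * d * L + 2 * L) ^ 3 * a ^ 2 * b)) * 1 :=
        mul_le_mul_of_nonneg_right (mul_le_mul (hu q).1 hk hK0 zero_le_one) zero_le_one
    _ = 1024000 * (2 * d * L + 2 * L) ^ 3 * a ^ 2 * b := by ring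

end Gauge

end Summit.QuantumFields.BalabanUV.T4Continuum.NE1p.B7AveragingCommutator

end
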